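import Summits.QuantumAdvantage.QuantumAdvantage.Theses.CubicForrelation
import Literature.Computability.QuantumComplexity.CubicForrelationEstimatorAnalysis
import HarnessLib.Audit

/-!
# Line `polarised-derivative-sampling` — crux `CubicForrelationInPrBPP` (stmt-QuantumAdvantage-2204)

Crux (route `QuantumAdvantage/CubicForrelation`, rank 4; the ¬X / dequantisation side):
`Summit.QuantumAdvantage.QuantumAdvantage.Theses.CubicForrelation.CubicForrelationInPrBPP`
= `cubicKForrelationProblem 2 ∈ PromiseBPP'` (the inline route signature IS this term by `rfl`,
`cubicKForrelationProblem_two_eq`, CubicForrelation.lean:178): cubic 2-fold Forrelation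
(B₂-circuits computing Boolean functions of 𝔽₂-degree ≤ 3, `n` even; YES `Φ ≥ 3/5`, NO `|Φ| ≤ 1/100`)
is in textbook promise-BPP.

Idea (crux idea `polarisationproof` = card `polarised-derivative-sampling`, ideator 3; triage r1: pass ×3):
polarise the SQUARE of the amplitude. `Φ² = 2ⁿ·bias(φ)²` with `φ(x,y) = a(x) + x·y + b(y)`, and
`bias(φ)² = E_h bias(D_h φ)`; for `h = (s,t)` the derivative SPLITS,
`D_{(s,t)}φ = D_s a(x) + t·x + s·y + s·t + D_t b(y)`, so
`Φ² = 2⁻ⁿ Σ_{s,t} (−1)^{s·t} A_s(t) B_t(s)` with `A_s = ` normalised Walsh spectrum of the QUADRATIC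
derivative `D_s a` (deg a ≤ 3). Sample `(s,t) ~ μ = 2⁻ⁿ A_s(t)²` (s uniform; t uniform on the Dickson
coset supporting row s), average `Z = (−1)^{s·t} B_t(s)/A_s(t)`: `E Z = Φ²`, `E Z² ≤ 1` (Parseval in s),
Chebyshev, threshold 0.18.

STATUS OF THE LINE: **COMPLETE — zero open stubs.** Every step of the idea is already a theorem of the
tree (Literature, sorry-free, standard axioms), landed 2026-08-15/16 (p71055/p71753 sampler, p71421
machine, p71991 Gauss sums, p72496 analysis), and their composition
`CubicDequant.cubicKForrelationProblem_two_mem_PromiseBPP'` (CubicForrelationEstimatorAnalysis.lean:636)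
closes the crux BY NAME with one `exact` (below, `CubicForrelationInPrBPP_of`). A 2–7-stub skeleton
would be pure costume (every stub a restatement of a landed theorem), so none is registered; this file
is the built line. Step ↦ landed declaration (each restated below as a kernel-checked `example` closed
by the landed lemma — `example`s rather than named theorems so that the file declares exactly ONE
constant, the composition, and no orphans):

* §1 polarisation identity `2^{3n} Φ² = Σ_{h,u} T_f(h,u) T_g(u,h)` (all f g, no degree hypothesis)
  ↦ `DerivativeWalsh.two_pow_mul_forrelation_sq` (ForrelationDerivativeTables.lean:180) — `step1_polarisation`;
* §2.1 Parseval per derivative (row mass `Σ_u T_f(h,u)² = 4ⁿ`) ↦ `DerivativeWalsh.sum_dwt_sq_of_sq`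
  (:217) — `step2_rowMass`;
* §3.2 degree drop `deg a ≤ 3 ⇒ D_h a quadratic` ↦ `CubicDequant.Df_quadratic` (Analysis:191) — `step3_degreeDrop`;
* §2.3 moments of the one-block statistic `X(h,w) = T_g(u,h)/T_f(h,u)`, `u = u_{D_h f}(w)` (the exact
  quadratic Fourier sampler `QuadSampler.uV`, QuadraticFourierSampler(Proofs).lean = §3.3 coset sampling):
  `Σ X = 4ⁿ Φ²`, `Σ X² ≤ 4ⁿ` ↦ `CubicDequant.sum_Xst_eq` / `sum_Xst_sq_le` (:216/:237) — `step4_mean`,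
  `step4_secondMoment`;
* §3.0 succinct-input guard (`Φ ≥ 3/5 ⇒ n ≤ |x| + 1`) ↦ `CubicDequant.guard_of_isYes` (:479) — `step5_guard`;
* §2.4 Chebyshev over independent coin blocks (N = 128 > 1/(3·0.17²), threshold 9/50) ↦
  `CubicDequant.card_deviation_mul_sq_le'`, `good_yes`, `bad_no` (:61/:530/:562);
* §3.4–3.6 exact Gauss sums + FP/TM plumbing (`accept`, `accept_codeFP`, `dec_mem_FP`,
  `mem_PromiseBPP'_of_accept`) ↦ CubicForrelationEstimatorMachine.lean; wrapper
  `cubic_two_mem_PromiseBPP'_of_bounds`.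

Disproof used (standing disprover, gen 2, evidence notes on the item; the file at payload.disproof_path
is not mounted on this hub): hypothesis lattice — `Even n` NOT load-bearing (the landed proof never uses
it), `deg ≤ 3` and `k = 2` load-bearing (used exactly at `step3_degreeDrop` and at the two-sided split
of `step1_polarisation`); landed Negative lemmas `Negative/SignedSlice.lean` (Φ²-engine is sign-blind),
`NoJunk.lean` (promise non-degenerate), `FlatSign.lean` concern the SIGNED rung (items 13931–13933),
not this crux; nothing here is an instance they refute (checked: scratch file importing all three
alongside this line elaborates, folder Scratch.lean).
-/

set_option linter.dupNamespace false

namespace Summit.QuantumAdvantage.QuantumAdvantage.Cruxes.CubicForrelationInPrBPP.PolarisedDerivativeSampling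

open Finset
open Literature.Computability.QuantumComplexity
open Literature.Computability.QuantumComplexity.DerivativeWalsh (dwt)

variable {n : ℕ}

/- `step1_polarisation` — §1 of the idea — the polarisation identity, for ALL Boolean `f g` (no degree hypothesis):
`2^{3n} · Φ(f,g)² = Σ_{h,u} T_f(h,u) · T_g(u,h)`. Landed: `DerivativeWalsh.two_pow_mul_forrelation_sq`. -/
example (f g : (Fin n → Bool) → Bool) :
    (2 : ℝ) ^ (3 * n) * forrelation f g ^ 2 =
      ∑ h, ∑ u, dwt (fun x => signOf (f x)) h u * dwt (fun y => signOf (g y)) u h :=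
  DerivativeWalsh.two_pow_mul_forrelation_sq f g

/- `step2_rowMass` — §2.1 — Parseval per derivative: every row of the table of a `±1`-valued function has mass `4ⁿ`
(so `μ(h,u) = T_f(h,u)²/8ⁿ` is a probability law with uniform `h`-marginal).
Landed: `DerivativeWalsh.sum_dwt_sq_of_sq`. -/
example (f : (Fin n → Bool) → ℝ) (hf : ∀ x, f x ^ 2 = 1) (h : Fin n → Bool) :
    ∑ u, dwt f h u ^ 2 = (4 : ℝ) ^ n :=
  DerivativeWalsh.sum_dwt_sq_of_sq f hf h

/- `step3_degreeDrop` — §3.2 — the degree drop that makes every table entry an exact quadratic Gauss sum: a cubic `f` has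
quadratic derivatives `D_h f`. Landed: `CubicDequant.Df_quadratic`. -/
example {f : (Fin n → Bool) → Bool} (hf : IsDegLeFun 3 f) (h : Fin n → Bool) :
    QuadPolar.toZFun (CubicDequant.Df f h) ∈ CHHL2018.lowDeg n 2 :=
  CubicDequant.Df_quadratic hf h

/- `step4_mean` — §2.3 (mean) — the one-block statistic `X(h,w) = T_g(u,h)/T_f(h,u)` with `u` drawn by the exact
quadratic Fourier sampler is unbiased for `Φ²`: `Σ_{h,w} X(h,w) = 4ⁿ Φ²`. Landed: `CubicDequant.sum_Xst_eq`. -/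
example {f g : (Fin n → Bool) → Bool} (hf : IsDegLeFun 3 f) :
    ∑ h, ∑ w, CubicDequant.Xst f g h w = (4 : ℝ) ^ n * forrelation f g ^ 2 :=
  CubicDequant.sum_Xst_eq hf

/- `step4_secondMoment` — §2.3 (second moment) — `Σ_{h,w} X(h,w)² ≤ 4ⁿ`, i.e. `E X² ≤ 1` (Parseval in the other variable).
Landed: `CubicDequant.sum_Xst_sq_le`. -/
example {f g : (Fin n → Bool) → Bool} (hf : IsDegLeFun 3 f) :
    ∑ h, ∑ w, CubicDequant.Xst f g h w ^ 2 ≤ (4 : ℝ) ^ n :=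
  CubicDequant.sum_Xst_sq_le hf

/- `step5_guard` — §3.0 — the succinct-input guard: on a YES instance (`Φ ≥ 3/5`) at most one input wire is idle,
so `n ≤ |encode I| + 1` and `poly(n) = poly(|x|)`. Landed: `CubicDequant.guard_of_isYes`. -/
example (I : KForrelationInstance) (hk : I.k = 2) (hyes : I.IsYes) :
    I.n ≤ I.encode.length + 1 :=
  CubicDequant.guard_of_isYes I hk hyes

/-- **The composition — the crux BY NAME, no stubs, no `sorry`.** The route decl unfolds by `rfl` to
`cubicKForrelationProblem 2 ∈ PromiseBPP'` (`cubicKForrelationProblem_two_eq`), which is the landed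
theorem `CubicDequant.cubicKForrelationProblem_two_mem_PromiseBPP'` (machine: guard `k = 2 ∧ n ≤ |x|+1`;
`N = 128` rounds of `h` uniform, `u ∝ T_{C₀}(h,·)²` by the exact sampler, `Y = 8ⁿ T_{C₁}(u,h)/T_{C₀}(h,u)`;
accept iff mean ≥ 9/50). -/
theorem CubicForrelationInPrBPP_of :
    Summit.QuantumAdvantage.QuantumAdvantage.Theses.CubicForrelation.CubicForrelationInPrBPP :=
  CubicDequant.cubicKForrelationProblem_two_mem_PromiseBPP'

end Summit.QuantumAdvantage.QuantumAdvantage.Cruxes.CubicForrelationInPrBPP.PolarisedDerivativeSampling
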